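import Summits.HodgeConjecture.HodgeConjecture.Theorems.HeckePrymWeilHodgeWeilOfSemiregularCleanLciLifts
import HarnessLib

/-!
# `WeilTwelvefoldsSqrtMinus7` from `DeligneWeilFamily`, the registered stub `stub_semiregularCleanLci` (r2 shape), `Bloch1972_semiregularSubschemeLifts` and `fulton1998_flatFamily_cycleClass_specialises`

Route `HeckePrymWeil` (sub-problem `HodgeConjecture`); lead seat c15 of crux `WeilTwelvefoldsSqrtMinus7`
(stmt-HodgeConjecture-1261), line `semiregular-clean-lci-anchor`, reshape r2: the line's composition at
`(p, k) = (7, 6)` — the crux BY NAME from the route item `DeligneWeilFamily` (stmt-HodgeConjecture-16866), the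
registered stub `stub_semiregularCleanLci` of skeleton r2 (VERBATIM, as hypothesis; Bloch-input shape) and the two
named print facts `Bloch1972_semiregularSubschemeLifts`, `fulton1998_flatFamily_cycleClass_specialises` (shared
with crux 1076's line), via the general `hodgeWeil_of_semiregularCleanLciLifts_of_globalAction`.  CONDITIONAL on
those four; no `sorry`, no new definition.  (Companion of the r1 composition
`weilTwelvefoldsSqrtMinus7_of_deligneWeilFamily_of_semiregularCleanLci_of_blochSpread`, lead c14.)
-/

noncomputable section

-- every declaration of this problem lives in `Summit.HodgeConjecture.HodgeConjecture.…` (summit = sub-problem)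
set_option linter.dupNamespace false

open CategoryTheory AlgebraicGeometry Limits MonoidalCategory CartesianMonoidalCategory
open Literature.AlgebraicGeometry Literature.AlgebraicGeometry.Motives
  Literature.AlgebraicGeometry.HodgeTheory Literature.AlgebraicTopology.SingularHomology


namespace Summit.HodgeConjecture.HodgeConjecture.Theorems.WeilTwelvefoldsSqrtMinus7.SemiregularCleanLciAnchor

open Summit.HodgeConjecture.HodgeConjecture.Theorems.HeckePrymWeilLine
open Summit.HodgeConjecture.HodgeConjecture.Theses.HeckePrymWeil

/-- **`WeilTwelvefoldsSqrtMinus7` from the route item `DeligneWeilFamily`, the line's registered stub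
`stub_semiregularCleanLci` of skeleton r2 (VERBATIM, as hypothesis `h₂`), `Bloch1972_semiregularSubschemeLifts`
and `fulton1998_flatFamily_cycleClass_specialises`** — the composition of the line `semiregular-clean-lci-anchor`
(r2) with its fourth stub (the algebraicity-locus structure theorem) discharged in the tree and the spread glue
proved (`semiregularSpread_of_blochLifts_of_fulton`): the route item gives the `K`-action rendering
(`kAction_of_deligneWeilFamily`), hence the global action (`deligne1982_weilFamily_globalAction_of_kAction`), and
`hodgeWeil_of_semiregularCleanLciLifts_of_globalAction` at `(p, k) = (7, 6)` is the crux after the harmless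
recasts `12 = 2·6`, `(7 : ℤ) = ((7 : ℕ) : ℤ)`.
[cite: Bloch1972Semiregularity, Thm. (7.1), proof of Thm. (7.4), Remark (7.5)]
[cite: Fulton1998, §10.1 Cor. 10.1; §19.1 Lemma 19.1.1] [cite: Deligne1982HodgeCycles, proof of Thm. 4.8] -/
theorem weilTwelvefoldsSqrtMinus7_of_deligneWeilFamily_of_semiregularCleanLci_of_blochLifts_of_fulton
    (h₁ : DeligneWeilFamily)
    (h₂ : ∀ (Y : AbelianVariety ℂ) (Ψ : Y ⟶ Y), Y.dim = 2 * 6 → Ψ ≫ Ψ = -((7 : ℤ) • 𝟙 Y) →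
      (∃ (A₁ : AbelianVariety ℂ) (f₁ : Y ⟶ A₁.prod A₁) (g₁ : A₁.prod A₁ ⟶ Y) (m : ℕ),
          A₁.dim = 6 ∧ 0 < m ∧ f₁ ≫ g₁ = m • 𝟙 Y ∧ Flat f₁.hom.hom.hom.left ∧
          g₁ ≫ Ψ = AbelianVariety.prodLift (AbelianVariety.snd A₁ A₁ ≫ (-((7 : ℤ) • 𝟙 A₁)))
            (AbelianVariety.fst A₁ A₁) ≫ g₁) →
      ∀ (e : ProjectiveEmbedding Y.X) (a : complexBetti (projectiveSpace e.n ℂ) 2),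
        IsRationalClass a → a ≠ 0 →
        complexBetti.map Ψ.hom.hom.hom 2 (complexBetti.map e.ι 2 a) = (7 : ℂ) • complexBetti.map e.ι 2 a →
      ∀ (x₀ : complexBetti Y.X (2 * 6)),
        x₀ ∈ weilClassesOf Y Ψ 6 7 → x₀ ≠ 0 → IsRationalClass x₀ →
        IsOfHodgeType (2 * 6) Y.X (2 * 6) 6 6 x₀ →
      ∀ (X₀ : SchemeOver ℂ) (e' : Y.X ≅ X₀),
        ∃ (Z : Scheme.{0}) (i : Z ⟶ X₀.left) (θ : complexBetti (projectiveSpace e.n ℂ) (2 * 6)) (α : ℚ),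
          IsClosedImmersion i ∧ IsFiniteLocallyFree (Deformation.conormalSheaf i) ∧
          AlgebraicGeometry.IsIntegral Z ∧
          (∀ z : Z, ((6 : ℕ) : ℕ∞) ≤ Order.coheight (i.base z)) ∧
          (∃ z : Z, Order.coheight (i.base z) = ((6 : ℕ) : ℕ∞)) ∧
          IsBlochSemiregular i (2 * 6) 6 ∧ IsRationalClass θ ∧ α ≠ 0 ∧
          complexBetti.map e'.inv (2 * 6) ((α : ℂ) • x₀ + complexBetti.map e.ι (2 * 6) θ) ∈
            classesSupportedOn X₀ (Set.range i.base) (2 * 6))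
    (h₃a : Bloch1972_semiregularSubschemeLifts) (h₃b : fulton1998_flatFamily_cycleClass_specialises) :
    WeilTwelvefoldsSqrtMinus7 := by
  intro A φ hA hφ c hrat hH hW
  have hA' : A.dim = 2 * 6 := by simpa using hA
  have hφ' : φ ≫ φ = -(((7 : ℕ) : ℤ) • 𝟙 A) := by exact_mod_cast hφ
  have hW' : c ∈ Module.End.eigenspace (complexBetti.map (𝟙 A + φ).hom.hom.hom (2 * 6)).hom
        ((1 + Complex.I * (Real.sqrt ((7 : ℕ) : ℝ) : ℂ)) ^ (2 * 6)) ⊔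
      Module.End.eigenspace (complexBetti.map (𝟙 A + φ).hom.hom.hom (2 * 6)).hom
        ((1 - Complex.I * (Real.sqrt ((7 : ℕ) : ℝ) : ℂ)) ^ (2 * 6)) := by
    exact_mod_cast hW
  have hH' : IsOfHodgeType (2 * 6) A.X (2 * 6) 6 6 c := hH
  have hGA : deligne1982_weilFamily_globalAction :=
    deligne1982_weilFamily_globalAction_of_kAction (kAction_of_deligneWeilFamily h₁)
  -- the registered stub, recast to the general supply shape at `(p, k) = (7, 6)`
  have hS : ∀ (Y : AbelianVariety ℂ) (Ψ : Y ⟶ Y), Y.dim = 2 * 6 → Ψ ≫ Ψ = -(((7 : ℕ) : ℤ) • 𝟙 Y) →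
      (∃ (A₁ : AbelianVariety ℂ) (f₁ : Y ⟶ A₁.prod A₁) (g₁ : A₁.prod A₁ ⟶ Y) (m : ℕ),
          A₁.dim = 6 ∧ 0 < m ∧ f₁ ≫ g₁ = m • 𝟙 Y ∧ Flat f₁.hom.hom.hom.left ∧
          g₁ ≫ Ψ = AbelianVariety.prodLift (AbelianVariety.snd A₁ A₁ ≫ (-(((7 : ℕ) : ℤ) • 𝟙 A₁)))
            (AbelianVariety.fst A₁ A₁) ≫ g₁) →
      ∀ (e : ProjectiveEmbedding Y.X) (a : complexBetti (projectiveSpace e.n ℂ) 2),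
        IsRationalClass a → a ≠ 0 →
        complexBetti.map Ψ.hom.hom.hom 2 (complexBetti.map e.ι 2 a) =
          ((7 : ℕ) : ℂ) • complexBetti.map e.ι 2 a →
      ∀ (x₀ : complexBetti Y.X (2 * 6)),
        x₀ ∈ weilClassesOf Y Ψ 6 7 → x₀ ≠ 0 → IsRationalClass x₀ →
        IsOfHodgeType (2 * 6) Y.X (2 * 6) 6 6 x₀ →
      ∀ (X₀ : SchemeOver ℂ) (e' : Y.X ≅ X₀),
        ∃ (Z : Scheme.{0}) (i : Z ⟶ X₀.left) (θ : complexBetti (projectiveSpace e.n ℂ) (2 * 6)) (α : ℚ),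
          IsClosedImmersion i ∧ IsFiniteLocallyFree (Deformation.conormalSheaf i) ∧
          AlgebraicGeometry.IsIntegral Z ∧
          (∀ z : Z, ((6 : ℕ) : ℕ∞) ≤ Order.coheight (i.base z)) ∧
          (∃ z : Z, Order.coheight (i.base z) = ((6 : ℕ) : ℕ∞)) ∧
          IsBlochSemiregular i (2 * 6) 6 ∧ IsRationalClass θ ∧ α ≠ 0 ∧
          complexBetti.map e'.inv (2 * 6) ((α : ℂ) • x₀ + complexBetti.map e.ι (2 * 6) θ) ∈
            classesSupportedOn X₀ (Set.range i.base) (2 * 6) := by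
    intro Y Ψ hY hΨ htensor e a ha ha0 hKsym x₀ hx₀ hx₀ne hx₀rat hx₀H X₀ e'
    have hΨ' : Ψ ≫ Ψ = -((7 : ℤ) • 𝟙 Y) := by exact_mod_cast hΨ
    have htensor' : ∃ (A₁ : AbelianVariety ℂ) (f₁ : Y ⟶ A₁.prod A₁) (g₁ : A₁.prod A₁ ⟶ Y) (m : ℕ),
        A₁.dim = 6 ∧ 0 < m ∧ f₁ ≫ g₁ = m • 𝟙 Y ∧ Flat f₁.hom.hom.hom.left ∧
        g₁ ≫ Ψ = AbelianVariety.prodLift (AbelianVariety.snd A₁ A₁ ≫ (-((7 : ℤ) • 𝟙 A₁)))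
          (AbelianVariety.fst A₁ A₁) ≫ g₁ := by
      obtain ⟨A₁, f₁, g₁, m, hA₁, hm, hfg, hf, hg₁⟩ := htensor
      exact ⟨A₁, f₁, g₁, m, hA₁, hm, hfg, hf, by exact_mod_cast hg₁⟩
    have hKsym' : complexBetti.map Ψ.hom.hom.hom 2 (complexBetti.map e.ι 2 a) =
        (7 : ℂ) • complexBetti.map e.ι 2 a := by exact_mod_cast hKsym
    exact h₂ Y Ψ hY hΨ' htensor' e a ha ha0 hKsym' x₀ hx₀ hx₀ne hx₀rat hx₀H X₀ e'
  exact hodgeWeil_of_semiregularCleanLciLifts_of_globalAction hGA (p := 7) (by norm_num) (by norm_num) le_rfl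
    (k := 6) (by norm_num) hS h₃a h₃b A φ hA' hφ' c hrat hH' hW'

end Summit.HodgeConjecture.HodgeConjecture.Theorems.WeilTwelvefoldsSqrtMinus7.SemiregularCleanLciAnchor

end
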